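import Literature.Barriers.CriticalPhenomena.TimarLevelComponents
import Literature.Barriers.CriticalPhenomena.TimarHeavyClustersErgodic
import Literature.Barriers.CriticalPhenomena.SubexponentialGrowthZdUnimodular
import HarnessLib

/-!
# Timár 2006, Cor. 5.7 (heavy clusters): the printed proof, from Thm. 5.5 and BLPS — PROVED
# as a reduction

Barrier catalogue `Literature/Barriers/CriticalPhenomena/`; the assembly of the programme behind
the named fact `Timar2006_notInfinitelyManyHeavyCriticalClusters` (`TimarCriticalNonunimodular.lean`):

> **Corollary 5.7** (proof, heavy clusters). "Corollary 5.6 shows that if there were infinitely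
> many of them, then the percolation restricted to some union `L` of finitely many levels would
> also have infinitely many infinite clusters. However, the action of `Aut(G)` on `L` is
> quasi-transitive and unimodular, in which case it is known that the existence of infinitely many
> infinite Bernoulli clusters implies that their critical probability is `< 1` (see [BLPS 1999]).
> This would contradict the definition of `p_c`." (Á. Timár, Ann. Probab. 34 (2006), p. 2361.)

What "[1]" supplies is the second half of the proof of Lyons–Peres 2016, Thm. 8.21 (infinitely
many infinite clusters at `p_c` are impossible on a connected, quasi-transitive, unimodular graph:
insertion tolerance gives a cluster with three ends, Lemma 7.7 a forest, Thm. 8.19 `p_c(𝔉) < 1`,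
contradicting `p_c(ω_{p_c}) = 1`), PROVED in the tree for every connected, locally finite,
quasi-transitive, unimodular graph, amenable or not
(`ae_numInfiniteClusters_ne_top_of_isGraphUnimodular`, `SubexponentialGrowthZdUnimodular.lean`;
it discharges the named fact `BenjaminiLyonsPeresSchramm1999_numCriticalClusters_ne_top`). Two
points of the printed argument need care and are made precise here:

1. The three-ends step of [1] lives in ONE CONNECTED COMPONENT of the graph carrying the
   percolation, and a finite union of levels induces in general a disconnected graph (Cor. 5.8:
   "suppose that the restriction of `G` to any finite union of its levels induces only finite
   components"). Accordingly Cor. 5.6's "Let `L₃` be a finite set of levels such that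
   `L₁ ∪ L₂ ∪ L₃ =: L` is connected (`L₃` can be chosen as the set of levels that a finite path
   that intersects each level of `L₁ ∪ L₂` visits)" is read as: the two infinite constrained
   clusters produced by Thm. 5.5 inside two distinct heavy clusters lie, after adding the levels
   of a connecting path, in a common component `K` of the union (`exists_two_infinite_clusters_levelComponent`).
   We therefore start from Thm. 5.5 (`Timar2006_finiteLevelUnion`) rather than from the vendored
   Cor. 5.6 (`Timar2006_levelUnion_infinitelyManyClusters`, which only records `N = ∞` on the whole
   union and is too weak for the component-wise application of [1]).
2. "The action of `Aut(G)` on `L` is quasi-transitive and unimodular" concerns Timár's subgroup;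
   the catalogue's facts concern the full automorphism group of the connected graph `G.induce K`.
   The passage is Lyons–Peres 2016, Exercise 8.8 (`TimarLevelComponents.lean`:
   `levelComponent_isQuasiTransitive`, `levelComponent_isGraphUnimodular`).

With these, on each component graph `X = G.induce K` (connected, locally finite, countable,
quasi-transitive, unimodular, `p_c(X) ≥ p_c(G)`): at `p = p_c(G)` the restricted configuration
has almost surely at most one infinite cluster (`ae_numInfiniteClusters_restrict_le_one`:
Newman–Schulman on `X`; `p < p_c(X)` — nothing percolates; `p = p_c(X)` — the
unimodular theorem just quoted), while Thm. 5.5 and two distinct heavy clusters produce a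
component with two (`exists_two_infinite_clusters_levelComponent`); "infinitely many heavy
clusters with positive probability" is upgraded to "almost surely" by ergodicity
(`ae_infinite_heavyClusters_of_not_ae`, `TimarHeavyClustersErgodic.lean`).

Main result: `Timar2006_notInfinitelyManyHeavyCriticalClusters_of_finiteLevelUnion` — Thm. 5.5
implies the heavy half of Cor. 5.7. Trust base of the heavy half
(`Timar2006_notInfinitelyManyHeavyCriticalClusters`) after this file: the single named fact
`Timar2006_finiteLevelUnion` (Timár's Thm. 5.5).

## References

* Á. Timár, *Percolation on nonunimodular transitive graphs*, Ann. Probab. 34 (2006) 2344–2364: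
  §2, Thm. 5.5, Cor. 5.6 (proof), Cor. 5.7 (proof), Cor. 5.8. [Timar2006]
* R. Lyons, Y. Peres, *Probability on Trees and Networks*, CUP 2016: Thm. 7.5, Thm. 7.6,
  Exercise 8.8, Thm. 8.21 (proof, second half). [LyonsPeres2016]
* I. Benjamini, R. Lyons, Y. Peres, O. Schramm, GAFA 9 (1999) 29–66 (Timár's [1]).
  [BenjaminiLyonsPeresSchramm1999]
-/

noncomputable section

namespace Literature.Barriers.CriticalPhenomena

open _root_.MeasureTheory _root_.Filter Literature.Probability.LatticeModels
  Literature.Probability.Percolation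
open scoped ENNReal

variable {V : Type*}

/-! ### Constrained clusters inside a level component -/

/-- **Inside a component, constraining to the component or to the whole union is the same**: for
`y` in the component `K` of `y₁ ∈ L` (`L` a finite union of levels), the open cluster of `y` with
steps in `L` equals the open cluster of `y` with steps in `K`. [folklore] -/
theorem openClusterIn_levelComponent_eq (G : SimpleGraph V) (S : Finset V) {y₁ y : V}
    (hy₁ : y₁ ∈ levelUnion G S) (hy : y ∈ levelComponent G S y₁) (ω : BondConfig V) :
    openClusterIn (withinGraph G (levelComponent G S y₁)) ω y =
      openClusterIn (withinGraph G (levelUnion G S)) ω y := by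
  refine Set.Subset.antisymm (openClusterIn_mono_graph
    (withinGraph_mono G (levelComponent_subset_levelUnion hy₁)) ω y) ?_
  intro z hz
  rw [mem_openClusterIn_iff] at hz ⊢
  obtain ⟨w⟩ := hz
  -- every vertex along an `L`-constrained open walk from `y ∈ K` stays in `K`
  suffices h : ∀ {a b : V} (w : (openGraph ω ⊓ withinGraph G (levelUnion G S)).Walk a b),
      a ∈ levelComponent G S y₁ →
        (openGraph ω ⊓ withinGraph G (levelComponent G S y₁)).Reachable a b from h w hy
  intro a b w
  induction w with
  | nil => exact fun _ => SimpleGraph.Reachable.refl _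
  | @cons a b c hadj w ih =>
    intro ha
    rw [SimpleGraph.inf_adj, withinGraph_adj] at hadj
    have hb : b ∈ levelComponent G S y₁ :=
      SimpleGraph.Reachable.trans ha (SimpleGraph.Adj.reachable
        (show (withinGraph G (levelUnion G S)).Adj a b from hadj.2))
    have h1 : (openGraph ω ⊓ withinGraph G (levelComponent G S y₁)).Adj a b := by
      rw [SimpleGraph.inf_adj, withinGraph_adj]
      exact ⟨hadj.1, hadj.2.1, ha, hb⟩
    exact h1.reachable.trans (ih hb)

/-- **Two distinct infinite constrained clusters in one component give `N ≥ 2` for the induced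
percolation on the component** (configurations opening only edges of `G`). [folklore] -/
theorem two_le_numInfiniteClusters_restrict (G : SimpleGraph V) (S : Finset V) {y₁ y₂ : V}
    (hy₁ : y₁ ∈ levelUnion G S) (hy₂ : y₂ ∈ levelComponent G S y₁) {ω : BondConfig V}
    (hω : ω ⊆ G.edgeSet)
    (h₁ : (openClusterIn (withinGraph G (levelUnion G S)) ω y₁).Infinite)
    (h₂ : (openClusterIn (withinGraph G (levelUnion G S)) ω y₂).Infinite)
    (h₁₂ : y₂ ∉ openClusterIn (withinGraph G (levelUnion G S)) ω y₁) :
    (2 : ℕ∞) ≤ numInfiniteClusters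
      (restrictConfig (Subtype.val : levelComponent G S y₁ → V) ω) := by
  classical
  set K := levelComponent G S y₁ with hK
  set ω' := restrictConfig (Subtype.val : K → V) ω with hω'
  have hy₁K : y₁ ∈ K := mem_levelComponent_self G S y₁
  have hC₁ : Subtype.val '' openCluster ω' ⟨y₁, hy₁K⟩ =
      openClusterIn (withinGraph G (levelUnion G S)) ω y₁ := by
    rw [hω', image_openCluster_restrictConfig G K hω hy₁K, openClusterIn_levelComponent_eq G S hy₁ hy₁K]
  have hC₂ : Subtype.val '' openCluster ω' ⟨y₂, hy₂⟩ =
      openClusterIn (withinGraph G (levelUnion G S)) ω y₂ := by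
    rw [hω', image_openCluster_restrictConfig G K hω hy₂, openClusterIn_levelComponent_eq G S hy₁ hy₂]
  have hinf₁ : (openCluster ω' ⟨y₁, hy₁K⟩).Infinite :=
    Set.Infinite.of_image Subtype.val (by rw [hC₁]; exact h₁)
  have hinf₂ : (openCluster ω' ⟨y₂, hy₂⟩).Infinite :=
    Set.Infinite.of_image Subtype.val (by rw [hC₂]; exact h₂)
  have hnr : ¬ (openGraph ω').Reachable ⟨y₁, hy₁K⟩ ⟨y₂, hy₂⟩ := by
    intro hr
    apply h₁₂
    rw [← hC₁]
    exact ⟨⟨y₂, hy₂⟩, hr, rfl⟩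
  have hne : (⟨y₁, hy₁K⟩ : K) ≠ ⟨y₂, hy₂⟩ := fun h => hnr (h ▸ SimpleGraph.Reachable.refl _)
  rw [show (2 : ℕ∞) = ((2 : ℕ) : ℕ∞) from rfl, ← mem_atLeastInfClusters_iff]
  refine ⟨{⟨y₁, hy₁K⟩, ⟨y₂, hy₂⟩}, Finset.card_pair hne, ?_, ?_⟩
  · intro x hx
    rw [Finset.mem_insert, Finset.mem_singleton] at hx
    rcases hx with rfl | rfl
    · exact hinf₁
    · exact hinf₂
  · rw [Finset.coe_pair, Set.pairwise_pair]
    intro _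
    exact ⟨hnr, fun h => hnr h.symm⟩

/-! ### Two heavy clusters and Thm. 5.5 give a component with two infinite constrained clusters -/

/-- **The combinatorial core of the proof of Cor. 5.6/5.7**: if `ω ⊆ E(G)` has two distinct
heavy clusters and every infinite cluster contains an infinite cluster constrained to some finite
union of levels (the conclusion of Thm. 5.5), then for some finite `S'` and some `y₁` of the union
`L(S')`, the induced percolation on the component of `y₁` has at least two infinite clusters (the
levels visited by a `G`-path from `y₁` to `y₂` are added to put both witnesses in one component:
"`L₃` can be chosen as the set of levels that a finite path that intersects each level of
`L₁ ∪ L₂` visits", proof of Cor. 5.6). [cite: Timar2006, Cor. 5.6 (proof) and Cor. 5.7 (proof)] -/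
theorem exists_two_infinite_clusters_levelComponent (G : SimpleGraph V) [G.LocallyFinite]
    (hconn : G.Connected) (o : V) {ω : BondConfig V} (hω : ω ⊆ G.edgeSet)
    (hheavy : (heavyClusters G o ω).Infinite)
    (h55 : ∀ x : V, IsHeavy G o (openCluster ω x) → ∃ S : Finset V, ∃ y ∈ openCluster ω x,
      (openClusterIn (withinGraph G (levelUnion G S)) ω y).Infinite) :
    ∃ (S : Finset V) (y₁ : V), y₁ ∈ levelUnion G S ∧
      (2 : ℕ∞) ≤ numInfiniteClusters (restrictConfig (Subtype.val : levelComponent G S y₁ → V) ω) := by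
  classical
  -- two distinct heavy clusters and representatives `x₁`, `x₂`
  obtain ⟨C₁, hC₁, C₂, hC₂, hne⟩ := hheavy.nontrivial
  have hrep : ∀ C : (openGraph ω).ConnectedComponent, ∃ v, (openGraph ω).connectedComponentMk v = C :=
    fun C => C.ind fun v => ⟨v, rfl⟩
  obtain ⟨x₁, rfl⟩ := hrep C₁
  obtain ⟨x₂, rfl⟩ := hrep C₂
  rw [connectedComponentMk_mem_heavyClusters_iff] at hC₁ hC₂
  have hx₁₂ : ¬ (openGraph ω).Reachable x₁ x₂ := fun h => hne (SimpleGraph.ConnectedComponent.sound h)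
  -- Thm. 5.5 witnesses inside the two clusters
  obtain ⟨S₁, y₁, hy₁, hD₁⟩ := h55 x₁ hC₁
  obtain ⟨S₂, y₂, hy₂, hD₂⟩ := h55 x₂ hC₂
  -- add the levels of a connecting path
  set w : G.Walk y₁ y₂ := (hconn.preconnected y₁ y₂).some with hw
  set S : Finset V := S₁ ∪ S₂ ∪ w.support.toFinset with hS
  have hS₁ : S₁ ⊆ S := Finset.subset_union_left.trans Finset.subset_union_left
  have hS₂ : S₂ ⊆ S := Finset.subset_union_right.trans Finset.subset_union_left
  have hsupp : ∀ z ∈ w.support, z ∈ levelUnion G S := fun z hz =>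
    mem_levelUnion_of_mem G (Finset.mem_union_right _ (List.mem_toFinset.2 hz))
  have hy₁L : y₁ ∈ levelUnion G S := hsupp y₁ (SimpleGraph.Walk.start_mem_support w)
  have hy₂K : y₂ ∈ levelComponent G S y₁ := reachable_withinGraph_of_support_subset G w hsupp
  -- the witnesses stay infinite in the larger union and lie in distinct clusters
  have hD₁' : (openClusterIn (withinGraph G (levelUnion G S)) ω y₁).Infinite :=
    hD₁.mono (openClusterIn_mono_graph (withinGraph_mono G (levelUnion_mono G hS₁)) ω y₁)
  have hD₂' : (openClusterIn (withinGraph G (levelUnion G S)) ω y₂).Infinite :=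
    hD₂.mono (openClusterIn_mono_graph (withinGraph_mono G (levelUnion_mono G hS₂)) ω y₂)
  have h₁₂ : y₂ ∉ openClusterIn (withinGraph G (levelUnion G S)) ω y₁ := by
    intro h
    have h' : (openGraph ω).Reachable y₁ y₂ := openClusterIn_subset_openCluster _ ω y₁ h
    exact hx₁₂ ((hy₁.trans h').trans (show (openGraph ω).Reachable y₂ x₂ from hy₂.symm))
  exact ⟨S, y₁, hy₁L, two_le_numInfiniteClusters_restrict G S hy₁L hy₂K hω hD₁' hD₂' h₁₂⟩

/-! ### On a component, at `p_c(G)`, the induced percolation has a.s. at most one infinite cluster -/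

/-- **The input from [1], component-wise.** Let `G` be connected, locally finite and
transitive, `S` finite, `y₁ ∈ L(S)` and `K` its component; `X = G.induce K` is connected, locally
finite, quasi-transitive and unimodular (`TimarLevelComponents.lean`) with `p_c(X) ≥ p_c(G)`.
Bernoulli(`p_c(G)`) percolation on `X` has almost surely at most one infinite cluster: by
Newman–Schulman `N ∈ {0, 1, ∞}` a.s.; if `p_c(G) < p_c(X)` nothing percolates; if
`p_c(G) = p_c(X)`, `N = ∞` is excluded by the unimodular theorem
`ae_numInfiniteClusters_ne_top_of_isGraphUnimodular` (Lyons–Peres 2016, proof of Thm. 8.21,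
second half; proved in the tree).
[cite: Timar2006, Cor. 5.7 (proof: "the action of Aut(G) on L is quasi-transitive and unimodular, in which case it is known … (see [1])")]
[cite: LyonsPeres2016, Thm. 8.21 (proof, second half) and Thm. 7.6] -/
theorem ae_numInfiniteClusters_induce_le_one {V : Type}
    (G : SimpleGraph V) [G.LocallyFinite] (hconn : G.Connected) (ht : IsGraphTransitive G)
    (o : V) (S : Finset V) {y₁ : V} (hy₁ : y₁ ∈ levelUnion G S) :
    ∀ᵐ ω' ∂(bondPercolation (G.induce (levelComponent G S y₁))
        ⟨criticalProb G o, criticalProb_mem_Icc G o⟩), numInfiniteClusters ω' ≤ 1 := by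
  classical
  haveI : Countable V := countable_of_connected_of_locallyFinite G hconn o
  set K := levelComponent G S y₁ with hK
  set X := G.induce K with hX
  set pc : unitInterval := ⟨criticalProb G o, criticalProb_mem_Icc G o⟩ with hpc
  haveI : X.LocallyFinite := induceLocallyFinite G K
  have hconnX : X.Connected := levelComponent_connected S y₁
  have hqtX : IsQuasiTransitive X := levelComponent_isQuasiTransitive hconn ht S hy₁
  have hUX : IsGraphUnimodular X := levelComponent_isGraphUnimodular hconn ht S hy₁
  set x' : K := ⟨y₁, mem_levelComponent_self G S y₁⟩ with hx'
  -- `N ∈ {0, 1, ∞}` a.s. on `X`; the first two cases are fine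
  rcases ae_numInfiniteClusters_trichotomy_of_isQuasiTransitive X hconnX hqtX pc with h0 | h1 | hT
  · filter_upwards [h0] with ω hω using hω ▸ zero_le_one
  · filter_upwards [h1] with ω hω using hω.le
  exfalso
  -- `N = ∞` a.s. is impossible
  have hfalse : ∀ᵐ ω' ∂(bondPercolation X pc), False := by
    by_cases hlt : (pc : ℝ) < criticalProb X x'
    · -- subcritical on `X`: nothing percolates, `N = 0`
      have hθ : ∀ z : K, bondPercolation X pc (percolatesAt z) = 0 := by
        intro z
        have hz : (pc : ℝ) < criticalProb X z := by
          rwa [← criticalProb_eq_of_reachable X (hconnX.preconnected x' z)]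
        have h := theta_eq_zero_of_lt_criticalProb_holds X z pc hz
        rwa [theta, measureReal_eq_zero_iff] at h
      have hno : ∀ᵐ ω' ∂(bondPercolation X pc), ∀ z : K, ω' ∉ percolatesAt z := by
        rw [ae_all_iff]
        intro z
        exact measure_eq_zero_iff_ae_notMem.1 (hθ z)
      filter_upwards [hT, hno] with ω' hω' hno'
      have h0 : numInfiniteClusters ω' = 0 := by
        by_contra hne
        obtain ⟨z, hz⟩ := (numInfiniteClusters_ne_zero_iff ω').1 hne
        exact hno' z hz
      rw [h0] at hω'
      exact ENat.zero_ne_top hω'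
    · -- `p_c(X) = p_c(G)`: the unimodular quasi-transitive graph `X` has no `N = ∞` at `p_c(X)`
      have hge : criticalProb X x' ≤ pc := not_lt.1 hlt
      have hle : (pc : ℝ) ≤ criticalProb X x' := by
        show criticalProb G o ≤ criticalProb X x'
        rw [criticalProb_eq_of_reachable G (hconn.preconnected o y₁)]
        exact criticalProb_le_induce theta_induce_le_holds G K y₁ (mem_levelComponent_self G S y₁)
      have heq : (⟨criticalProb X x', criticalProb_mem_Icc X x'⟩ : unitInterval) = pc :=
        Subtype.ext (le_antisymm hge hle)
      have h := ae_numInfiniteClusters_ne_top_of_isGraphUnimodular X hconnX hqtX hUX x'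
      rw [heq] at h
      filter_upwards [hT, h] with ω' hω' hω'' using hω'' hω'
  have h := (ae_iff.1 hfalse)
  simp only [not_false_eq_true, Set.setOf_true, measure_univ] at h
  exact one_ne_zero h

/-- The same statement pulled back to `P_{p_c}^G`: almost surely the configuration restricted to
the component `K` has at most one infinite cluster (restriction coupling,
`bondPercolation_map_comap`). [cite: Timar2006, Cor. 5.7 (proof: "the percolation restricted to some union L of finitely many levels")] -/
theorem ae_numInfiniteClusters_restrict_le_one {V : Type} (G : SimpleGraph V) [G.LocallyFinite]
    (hconn : G.Connected) (ht : IsGraphTransitive G)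
    (o : V) (S : Finset V) {y₁ : V} (hy₁ : y₁ ∈ levelUnion G S) :
    ∀ᵐ ω ∂(bondPercolation G ⟨criticalProb G o, criticalProb_mem_Icc G o⟩),
      numInfiniteClusters (restrictConfig (Subtype.val : levelComponent G S y₁ → V) ω) ≤ 1 := by
  have hX := ae_numInfiniteClusters_induce_le_one G hconn ht o S hy₁
  have hmap : (bondPercolation G ⟨criticalProb G o, criticalProb_mem_Icc G o⟩).map
      (restrictConfig (Subtype.val : levelComponent G S y₁ → V)) =
        bondPercolation (G.induce (levelComponent G S y₁))
          ⟨criticalProb G o, criticalProb_mem_Icc G o⟩ :=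
    bondPercolation_map_comap G Subtype.val_injective _
  rw [← hmap] at hX
  exact ae_of_ae_map (measurable_restrictConfig _).aemeasurable hX

/-! ### The heavy half of Cor. 5.7 from Thm. 5.5 -/

/-- **Timár 2006, Cor. 5.7 (heavy clusters), proof PROVED as a reduction to Thm. 5.5**: Thm. 5.5
(`Timar2006_finiteLevelUnion`) implies — with the theorem of Timár's "[1]" in the form proved in
the tree (`ae_numInfiniteClusters_ne_top_of_isGraphUnimodular`, the second half of the proof of
Lyons–Peres 2016, Thm. 8.21) — that on a connected, locally finite, transitive, nonunimodular
graph there are almost surely not infinitely many heavy clusters at `p_c`. Proof: if not, by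
ergodicity there are a.s. infinitely many heavy clusters
(`ae_infinite_heavyClusters_of_not_ae`); Thm. 5.5 then a.s. puts an infinite level-constrained
cluster inside every infinite cluster, so some component of some finite union of levels carries
two infinite constrained clusters (`exists_two_infinite_clusters_levelComponent`), an event which is
null for each of the countably many components (`ae_numInfiniteClusters_restrict_le_one`).
[cite: Timar2006, Cor. 5.7 (proof), Cor. 5.6 (proof), Thm. 5.5, §2]
[cite: LyonsPeres2016, Thm. 8.21 (proof, second half), Exercise 8.8, Thm. 7.5, Thm. 7.6] -/
theorem Timar2006_notInfinitelyManyHeavyCriticalClusters_of_finiteLevelUnion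
    (h55 : Timar2006_finiteLevelUnion) : Timar2006_notInfinitelyManyHeavyCriticalClusters := by
  intro V G _ hconn ht hU o
  classical
  by_contra hnot
  haveI : Countable V := countable_of_connected_of_locallyFinite G hconn o
  set pc : unitInterval := ⟨criticalProb G o, criticalProb_mem_Icc G o⟩ with hpc
  -- on a finite graph there are no heavy clusters at all
  rcases finite_or_infinite V with hfin | hinf
  · apply hnot
    filter_upwards with ω
    have hempty : heavyClusters G o ω = ∅ :=
      Set.eq_empty_of_forall_notMem fun C hC => (IsHeavy.infinite hconn hC) (Set.toFinite _)
    rw [hempty]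
    exact Set.finite_empty.not_infinite
  -- ergodicity: a.s. infinitely many heavy clusters
  have hae : ∀ᵐ ω ∂(bondPercolation G pc), (heavyClusters G o ω).Infinite :=
    ae_infinite_heavyClusters_of_not_ae G hconn ht.isQuasiTransitive o pc hnot
  -- Thm. 5.5
  have h55' := h55 G hconn ht hU o pc hae
  -- configurations open only edges of `G`
  have hE : ∀ᵐ ω ∂(bondPercolation G pc), ω ⊆ G.edgeSet := ProbabilityTheory.setBernoulli_ae_subset
  -- every component of every finite union of levels carries a.s. at most one infinite cluster
  have hall : ∀ᵐ ω ∂(bondPercolation G pc), ∀ (S : Finset V) (y₁ : V), y₁ ∈ levelUnion G S →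
      numInfiniteClusters (restrictConfig (Subtype.val : levelComponent G S y₁ → V) ω) ≤ 1 := by
    rw [ae_all_iff]
    intro S
    rw [ae_all_iff]
    intro y₁
    by_cases hy₁ : y₁ ∈ levelUnion G S
    · filter_upwards [ae_numInfiniteClusters_restrict_le_one G hconn ht o S hy₁] with ω hω _
        using hω
    · filter_upwards with ω h using absurd h hy₁
  -- contradiction
  have hfalse : ∀ᵐ ω ∂(bondPercolation G pc), False := by
    filter_upwards [hae, h55', hE, hall] with ω hω₁ hω₂ hω₃ hω₄
    obtain ⟨S, y₁, hy₁, h2⟩ := exists_two_infinite_clusters_levelComponent G hconn o hω₃ hω₁ hω₂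
    have h1 := hω₄ S y₁ hy₁
    have h21 : (2 : ℕ∞) ≤ 1 := h2.trans h1
    exact absurd h21 (by decide)
  have h := ae_iff.1 hfalse
  simp only [not_false_eq_true, Set.setOf_true, measure_univ] at h
  exact one_ne_zero h

/-- **The transitive "at most one infinite cluster at `p_c`" from Timár's two theorems**:
combining with the first sentence of the proof of Cor. 5.7
(`Timar2006_notInfinitelyManyCriticalClusters_of`, Thm. 4.3 = `Timar2006_noInfiniteLightClusters`)
and Newman–Schulman (`Timar2006_atMostOneCriticalClusterTransitive_of_halves`), Thm. 4.3 and
Thm. 5.5 give: on every connected, locally finite, transitive, nonunimodular graph, at `p_c`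
almost surely `N ≤ 1` — the transitive case of Hutchcroft's wording
`Timar2006_atMostOneCriticalCluster`, stated here as a corollary with explicit hypotheses (it is
an equivalent rewording of the printed Cor. 5.7, `Timar2006_notInfinitelyManyCriticalClusters`,
not a separately printed result). The trust base of `Timar2006_notInfinitelyManyCriticalClusters`
becomes {Thm. 4.3, Thm. 5.5} (`Timar2006_notInfinitelyManyCriticalClusters_of_theorems`).
[cite: Timar2006, Cor. 5.7 (proof)] [cite: LyonsPeres2016, Thm. 7.5] -/
theorem Timar2006_atMostOneCriticalClusterTransitive_of_theorems
    (h43 : Timar2006_noInfiniteLightClusters) (h55 : Timar2006_finiteLevelUnion)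
    {V : Type} (G : SimpleGraph V) [G.LocallyFinite] (hconn : G.Connected)
    (ht : IsGraphTransitive G) (hU : ¬ IsGraphUnimodular G) (x : V) :
    ∀ᵐ ω ∂(bondPercolation G ⟨criticalProb G x, criticalProb_mem_Icc G x⟩),
      numInfiniteClusters ω ≤ 1 :=
  Timar2006_atMostOneCriticalClusterTransitive_of_halves h43
    (Timar2006_notInfinitelyManyHeavyCriticalClusters_of_finiteLevelUnion h55) G hconn ht hU x

/-- Cor. 5.7 as printed (`Timar2006_notInfinitelyManyCriticalClusters`) from Thm. 4.3 and
Thm. 5.5. [cite: Timar2006, Cor. 5.7 (proof)] -/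
theorem Timar2006_notInfinitelyManyCriticalClusters_of_theorems
    (h43 : Timar2006_noInfiniteLightClusters) (h55 : Timar2006_finiteLevelUnion) :
    Timar2006_notInfinitelyManyCriticalClusters :=
  Timar2006_notInfinitelyManyCriticalClusters_of h43
    (Timar2006_notInfinitelyManyHeavyCriticalClusters_of_finiteLevelUnion h55)

end Literature.Barriers.CriticalPhenomena

end
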